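import Summits.ResolutionOfSingularities.ResolutionOfSingularities.Theorems.RadicialJungCleanModelsDimTwoFFiniteStep
import Literature.AlgebraicGeometry.Resolution.EmbeddedCurvePointBlowups
import Literature.AlgebraicGeometry.Resolution.RegularBlowup
import Summits.ResolutionOfSingularities.ResolutionOfSingularities.Theorems.RadicialJungCleanModelsGiraudPhaseA
import HarnessLib

/-!
# Route `RadicialJung`, crux `CleanModels` (stmt-15917): plumbing for compositions of point
# blowing ups of a regular surface over a field (T2 skeleton, stubs P1/P2)

Support file (OURS) for PROGRAMME-clean-dim2 / T2 (`HOME/L/res-L0-w81-pv-2/g5/T2Skeleton.lean`),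
line `via-clean-models` of crux `DescentPerfectToAll` (stmt-0549). Nothing here is a statement of
Hironaka's manuscript. The loop of the T2 skeleton blows up closed points of an integral regular
surface `X`, locally of finite type over a field `k`; this file proves that its invariants survive a
finite composition `π : X₁ → X` of point blowing ups (`IsPointBlowupComposition T π`):

* `exists_isIso_off_finite_of_isPointBlowupComposition` — `π` is an isomorphism over the complement
  of FINITELY MANY CLOSED points (the images of the centres);
* regularity of the stages is `isRegular_of_isPointBlowupComposition` of
  `RadicialJungCleanModelsGiraudPhaseA.lean` (res-L1-s13-pv-1, landed concurrently; the copy that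
  the first version of this file carried is withdrawn in its favour — one name, one module);
* `adm_of_isPointBlowupComposition` — the package used by the skeleton: `X₁` integral, compact,
  locally of finite type over `k`, regular, of the same dimension `2`, and a global function
  which is not a `p`-th power in `K(X)` stays so in `K(X₁)` (`π` is birational).

## References
* Q. Liu, Algebraic Geometry and Arithmetic Curves, §8.1, Thm. 1.19. [Liu2002]
* U. Görtz, T. Wedhorn, Algebraic Geometry I (2nd ed.), Prop. 13.91, 13.96. [GortzWedhorn2020]
-/

noncomputable section

set_option linter.dupNamespace false -- mandated namespace of this single-conjunct summit

open CategoryTheory AlgebraicGeometry TopologicalSpace IsLocalRing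
open Literature.AlgebraicGeometry.Resolution Literature.AlgebraicGeometry.Motives

namespace Summit.ResolutionOfSingularities.ResolutionOfSingularities.Theorems.RadicialJung.CleanModels

open Scheme.IdealSheafData

universe u

/-! ## An isomorphism off finitely many closed points -/

/-- **A composition of point blowing ups of an integral locally Noetherian scheme is an
isomorphism over the complement of finitely many closed points** (the images of the successive
centres; each blowing up is an isomorphism off its centre, GW 13.91 (3), and the earlier stages
are proper, hence closed maps). [cite: GortzWedhorn2020, Prop. 13.91 (3)] -/
theorem exists_isIso_off_finite_of_isPointBlowupComposition {X : Scheme.{u}} [IsIntegral X]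
    [IsLocallyNoetherian X] {T : Set X} :
    ∀ {X₁ : Scheme.{u}} {π : X₁ ⟶ X}, IsPointBlowupComposition T π →
      ∃ U : X.Opens, ((U : Set X)ᶜ).Finite ∧ (∀ x ∈ (U : Set X)ᶜ, IsClosed ({x} : Set X)) ∧
        IsIso (π ∣_ U) := by
  intro X₁ π h
  induction h with
  | nil =>
    refine ⟨⊤, by simp, by simp, ?_⟩
    infer_instance
  | @cons X'' X' τ σ x' hx' hσ hne hT hτ ih =>
    obtain ⟨U, hUfin, hUcl, hUiso⟩ := ih
    haveI := hσ.isProper inferInstance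
    -- the image of the new centre is a closed point
    have hσx : IsClosed ({σ.base x'} : Set X) := by
      rw [← Set.image_singleton]; exact σ.isClosedMap _ hx'
    set V : X.Opens := ⟨(U : Set X) \ {σ.base x'}, U.2.sdiff hσx⟩ with hV
    refine ⟨V, ?_, ?_, ?_⟩
    · refine (hUfin.union (Set.finite_singleton (σ.base x'))).subset ?_
      intro x hx
      by_cases hxU : x ∈ (U : Set X)
      · right
        by_contra hxa
        exact hx ⟨hxU, hxa⟩
      · exact Or.inl hxU
    · intro x hx
      by_cases hxU : x ∈ (U : Set X)
      · have hxa : x ∈ ({σ.base x'} : Set X) := by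
          by_contra hxa
          exact hx ⟨hxU, hxa⟩
        rw [Set.mem_singleton_iff.mp hxa]
        exact hσx
      · exact hUcl x hxU
    · have hVU : V ≤ U := fun x hx => hx.1
      have h2 : IsIso (σ ∣_ V) := isIso_morphismRestrict_of_le σ hVU
      have hdisj : Disjoint ((σ ⁻¹ᵁ V : X'.Opens) : Set X')
          ((vanishingIdeal (⟨{x'}, hx'⟩ : Closeds X')).support : Set X') := by
        rw [coe_support_vanishingIdeal]
        change Disjoint (σ.base ⁻¹' (V : Set X)) {x'}
        rw [Set.disjoint_singleton_right]
        intro hmem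
        exact hmem.2 rfl
      have h1 : IsIso (τ ∣_ (σ ⁻¹ᵁ V)) := hτ.isIso_morphismRestrict hdisj
      rw [morphismRestrict_comp]
      exact @IsIso.comp_isIso _ _ _ _ _ _ _ h1 h2

/-! ## The admissibility package -/

/-- **The invariants of the T2 loop survive a composition of point blowing ups.** For `X`
integral, quasi-compact, regular of dimension `2`, locally of finite type over a field `k` of
characteristic `p`, a composition `π : X₁ → X` of point blowing ups and `f ∈ Γ(X, 𝒪_X)` not a
`p`-th power in `K(X)`: `X₁` is integral, compact, locally of finite type over `k`, regular, of
dimension `2`, and `π^* f` is not a `p`-th power in `K(X₁)`.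
[cite: Liu2002, §8.1 Thm. 1.19] [cite: GortzWedhorn2020, Prop. 13.96] -/
theorem adm_of_isPointBlowupComposition (p : ℕ) (k : Type) [Field k] {X : Scheme.{0}}
    [IsIntegral X] [CompactSpace X] (q : X ⟶ Spec (.of k)) [LocallyOfFiniteType q]
    (hreg : Scheme.IsRegular X) (hdim : topologicalKrullDim X = 2) (f : Γ(X, ⊤))
    (hf : ∀ c : X.functionField, c ^ p ≠ X.presheaf.germ ⊤ (genericPoint X) trivial f)
    {T : Set X} {X₁ : Scheme.{0}} {π : X₁ ⟶ X} (hπ : IsPointBlowupComposition T π) :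
    ∃ (_ : IsIntegral X₁) (_ : CompactSpace X₁) (_ : LocallyOfFiniteType (π ≫ q)),
      Scheme.IsRegular X₁ ∧ topologicalKrullDim X₁ = 2 ∧
      ∀ c : X₁.functionField, c ^ p ≠ X₁.presheaf.germ ⊤ (genericPoint X₁) trivial (π.appTop f) := by
  haveI : IsLocallyNoetherian X := LocallyOfFiniteType.isLocallyNoetherian q
  haveI hX₁int : IsIntegral X₁ := hπ.isIntegral inferInstance
  haveI : IsProper π := hπ.isProper inferInstance
  haveI : CompactSpace X₁ := QuasiCompact.compactSpace_of_compactSpace π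
  haveI : LocallyOfFiniteType (π ≫ q) := inferInstance
  have hX₁reg : Scheme.IsRegular X₁ := isRegular_of_isPointBlowupComposition hreg hπ
  -- `π` is an isomorphism over a dense open containing the generic point
  obtain ⟨U, hUfin, hUcl, hUiso⟩ := exists_isIso_off_finite_of_isPointBlowupComposition hπ
  haveI := hUiso
  have hηX : ¬ IsClosed ({genericPoint X} : Set X) :=
    not_isClosed_singleton_genericPoint (by rw [hdim]; decide)
  have hηU : genericPoint X ∈ U := by
    by_contra h
    exact hηX (hUcl _ h)
  obtain ⟨x₁, hx₁⟩ := exists_preimage_of_isIso_morphismRestrict π U hηU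
  have hne : ((π ⁻¹ᵁ U : X₁.Opens) : Set X₁).Nonempty := ⟨x₁, show π.base x₁ ∈ U by rw [hx₁]; exact hηU⟩
  have hdim₁ : topologicalKrullDim X₁ = 2 :=
    (topologicalKrullDim_glue q (π ≫ q) π U hne).trans hdim
  -- `π^♯` is bijective
  have hUdense : Dense ((U : X.Opens) : Set X) := U.2.dense ⟨_, hηU⟩
  have hUdense' : Dense ((π ⁻¹ᵁ U : X₁.Opens) : Set X₁) := (π ⁻¹ᵁ U).2.dense hne
  haveI : IsDominant π := isDominant_of_isIso_morphismRestrict π U ⟨_, hηU⟩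
  have hbij : Function.Bijective (RatFn.functionFieldMap π) :=
    RatFn.functionFieldMap_bijective_of_isIso_morphismRestrict π U hUdense hUdense'
  refine ⟨hX₁int, inferInstance, inferInstance, hX₁reg, hdim₁, fun c => ?_⟩
  -- the germ of `π^* f` at the generic point is `π^♯` of the germ of `f`
  have hgerm : X₁.presheaf.germ ⊤ (genericPoint X₁) trivial (π.appTop f) =
      RatFn.functionFieldMap π (X.presheaf.germ ⊤ (genericPoint X) trivial f) := by
    have h1 := functionFieldMap_toFunctionField_germ π (U := ⊤) (genericPoint X₁) trivial f
    rw [toFunctionField_germ' (X := X) (U := ⊤) trivial trivial f] at h1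
    rw [h1, toFunctionField_germ' (X := X₁) (U := π ⁻¹ᵁ ⊤) trivial trivial]
    rfl
  rw [hgerm]
  exact ne_pow_of_bijective _ hbij p hf c

end Summit.ResolutionOfSingularities.ResolutionOfSingularities.Theorems.RadicialJung.CleanModels

end
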